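import Summits.AnomalousDissipation.AnomalousDissipation.Theorems.TwoAndHalfDTwohalfdNegCertificate

/-!
# The line `log-kantorovich-enstrophy-transfer` for the crux `TwoAndHalfD.TwohalfdNeg`
# (stmt-AnomalousDissipation-0211) at the resolution of ONE planar family / ONE planar force

The landed transfer certificate `Certificate.twohalfdNeg_of_subLogStrain` consumes the residual S6
(`stub_subLogStrain`) for ALL forces at once. Its engine is finer, and sub-cases of the crux (single
shell — landed —, two shells, co-moving classes, …) are settled force by force; this file states the
two sharper forms the composition actually proves, so that any future partial result on S6 plugs in
without touching the skeleton:

* `scalarNoAnomaly_of_subLogStrain_family` — **per planar family** (pure 2-D, no reduction): a global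
  Leray–Hopf family `v_j` of the steadily forced planar Navier–Stokes equations (`g` smooth,
  divergence free, mean zero; `ν_j → 0`; bounded `limsup`-mean energy) whose `limsup`-mean strain is
  sub-logarithmic, `⟨‖∇v_j‖₂⟩ / log(1/ν_j) → 0`, carries EVERY steadily sourced (`h` smooth, mean zero),
  bounded-variance weak scalar family at `Pr = 1` with vanishing `limsup`-mean dissipation
  `⟨ν_j‖∇θ_j‖²⟩ → 0` (S4 log-Kantorovich engine ⇒ S5' finite-window quiet on the grid ⇒ S3' grid age
  decoupling).
* `twohalfdNeg_twoHalf_of_subLogStrainFor` — **per planar force** (the crux restricted to the forces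
  `twoHalf g h` with a given planar part `g`): if every bounded-energy global Leray–Hopf family forced
  by THIS `g` has sub-logarithmic mean strain (`SubLogStrainFor g`, the force-wise residual), then for
  every smooth mean-zero source `h` every bounded-energy `x₃`-invariant global Leray–Hopf family on `T³`
  forced by `twoHalf g h`, `ν_j → 0`, arbitrary `L²` data, has `meanDissipation → 0` (reduction S1' +
  S2 + the per-family engine; the planar force returned by S1' is `g` itself,
  `Torus.twoHalf_left_injective`). The single-shell theorem `Certificate.twohalfdNeg_twoHalf_singleShell`
  is the instance `SubLogStrainFor g` := Tran–Shepherd (S6-mono).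

The file closes with the registered tools stub `stub_perForceCertificate` (conjunction of the two).
No new analysis: bookkeeping over the landed stubs S1', S2, S3', S4, S5'.  Supports stmt-AnomalousDissipation-0211.
-/

namespace Summit.AnomalousDissipation.AnomalousDissipation.Theorems.TwohalfdNeg.PerForce

open MeasureTheory Filter Topology
open scoped ENNReal NNReal
open Literature.Analysis.FunctionSpaces Literature.Analysis.FluidPDE
open Summit.AnomalousDissipation.AnomalousDissipation.Theorems.TwohalfdNeg

set_option linter.dupNamespace false

/-- **Per-family engine: a sub-log-strain planar Leray–Hopf family carries no steady-source scalar
anomaly at bounded variance.** For `g` smooth divergence-free mean-zero, `h` smooth mean-zero,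
`ν_j > 0` with `ν_j → 0`, global Leray–Hopf `v_j` forced by `g` with bounded `limsup`-mean energy and
`⟨‖∇v_j‖₂⟩ / log(1/ν_j) → 0`, and ANY `L²` data `θ₀_j` with global weak sourced scalars `θ_j` over `v_j`
of bounded `limsup`-mean variance: `⟨ν_j‖∇θ_j‖²⟩ → 0`. Composition S4 (`stub_releaseLogBound`) ⇒ S5'
(`stub_quietOfSubLogGrid`) ⇒ S3' (`stub_ageDecouplingGrid`). [folklore] -/
theorem scalarNoAnomaly_of_subLogStrain_family :
    ∀ (g : UnitAddTorus (Fin 2) → EuclideanSpace ℝ (Fin 2)) (h : UnitAddTorus (Fin 2) → ℝ),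
      Torus.IsSmooth g → Torus.IsDivFree g → Torus.HasZeroMean g →
      Torus.IsSmooth h → Torus.HasZeroMean h →
      ∀ (ν : ℕ → ℝ) (v₀ : ℕ → UnitAddTorus (Fin 2) → EuclideanSpace ℝ (Fin 2))
        (v : ℕ → ℝ → UnitAddTorus (Fin 2) → EuclideanSpace ℝ (Fin 2))
        (θ₀ : ℕ → UnitAddTorus (Fin 2) → ℝ) (θ : ℕ → ℝ → UnitAddTorus (Fin 2) → ℝ),
        (∀ j, 0 < ν j) → Tendsto ν atTop (𝓝 0) →
        (∀ j, Torus.IsGlobalLerayHopf (ν j) (fun _ => g) (v₀ j) (v j)) →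
        (∃ E : ℝ, ∀ j, meanEnergy (v j) ≤ E) →
        Tendsto (fun j => longTimeAvgSup (fun t => Real.sqrt (Torus.eGradNormSq (v j t)).toReal) /
          Real.log (ν j)⁻¹) atTop (𝓝 0) →
        (∀ j, MemLp (θ₀ j) 2 volume) →
        (∀ j, Torus.IsWeakScalarTransportForced (ν j) (v j) (fun _ => h) (θ₀ j) (θ j)) →
        (∃ E : ℝ, ∀ j, longTimeAvgSup (fun t => Torus.scalarL2Sq (θ j t)) ≤ E) →
        Tendsto (fun j => longTimeAvgSup (fun t => ν j * (Torus.eScalarGradNormSq (θ j t)).toReal))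
          atTop (𝓝 0) := by
  intro g h hgs hgd hgz hhs hhz ν v₀ v θ₀ θ hν hν0 hvLH hEv hsub hθ₀ hθw hEθ
  have hquiet := QuietOfSubLogGrid.stub_quietOfSubLogGrid
    (ReleaseLogBound.stub_releaseLogBound (d := Fin 2)) g hgs hgd hgz ν v₀ v hν hν0 hvLH hEv hsub h hhs hhz
  exact AgeDecouplingGrid.stub_ageDecouplingGrid g h hgs hgd hgz hhs hhz ν v₀ v θ₀ θ hν hvLH hEv hθ₀ hθw
    hEθ hquiet

/-- **Per-force certificate: `SubLogStrainFor g ⇒` the crux for every force with planar part `g`.**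
For `g` smooth divergence-free mean-zero on `T²` such that every bounded-energy global Leray–Hopf
family of planar NS_{ν_j} forced by `g` (`ν_j → 0`, arbitrary `L²` data) has
`⟨‖∇v_j‖₂⟩ / log(1/ν_j) → 0`, and for every smooth mean-zero source `h`: every family of
`x₃`-invariant global Leray–Hopf solutions of NS_{ν_j} on `T³` forced by `twoHalf g h`, `ν_j → 0`,
arbitrary `L²` data, `ν`-uniformly bounded `limsup`-mean energy, has `meanDissipation (ν j) (u j) → 0`.
Reduction S1' (`stub_reductionOffZero`; the returned planar force is `g`, `twoHalf_left_injective`) +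
S2 (`stub_planarNoAnomaly`) + `scalarNoAnomaly_of_subLogStrain_family` + squeeze. [folklore] -/
theorem twohalfdNeg_twoHalf_of_subLogStrainFor :
    ∀ (g : UnitAddTorus (Fin 2) → EuclideanSpace ℝ (Fin 2)),
      Torus.IsSmooth g → Torus.IsDivFree g → Torus.HasZeroMean g →
      (∀ (ν : ℕ → ℝ) (v₀ : ℕ → UnitAddTorus (Fin 2) → EuclideanSpace ℝ (Fin 2))
        (v : ℕ → ℝ → UnitAddTorus (Fin 2) → EuclideanSpace ℝ (Fin 2)),
        (∀ j, 0 < ν j) → Tendsto ν atTop (𝓝 0) →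
        (∀ j, Torus.IsGlobalLerayHopf (ν j) (fun _ => g) (v₀ j) (v j)) →
        (∃ E : ℝ, ∀ j, meanEnergy (v j) ≤ E) →
        Tendsto (fun j => longTimeAvgSup (fun t => Real.sqrt (Torus.eGradNormSq (v j t)).toReal) /
          Real.log (ν j)⁻¹) atTop (𝓝 0)) →
      ∀ (h : UnitAddTorus (Fin 2) → ℝ), Torus.IsSmooth h → Torus.HasZeroMean h →
      ∀ (ν : ℕ → ℝ) (u₀ : ℕ → UnitAddTorus (Fin 3) → EuclideanSpace ℝ (Fin 3))
        (u : ℕ → ℝ → UnitAddTorus (Fin 3) → EuclideanSpace ℝ (Fin 3)),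
        (∀ j, 0 < ν j) → Tendsto ν atTop (𝓝 0) →
        (∀ j, Torus.IsGlobalLerayHopf (ν j) (fun _ => Torus.twoHalf g h) (u₀ j) (u j)) →
        (∀ j (t : ℝ) (s : UnitAddCircle) (x : UnitAddTorus (Fin 3)),
          u j t (x + Pi.single (2 : Fin 3) s) = u j t x) →
        (∃ E : ℝ, ∀ j, meanEnergy (u j) ≤ E) →
        Tendsto (fun j => meanDissipation (ν j) (u j)) atTop (𝓝 0) := by
  intro g hgs hgd hgz hS6g h hhs hhz ν u₀ u hν hν0 hLH huinv hE
  have hfinv : ∀ (s : UnitAddCircle) (x : UnitAddTorus (Fin 3)),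
      Torus.twoHalf g h (x + Pi.single (2 : Fin 3) s) = Torus.twoHalf g h x := by
    intro s x
    rw [Torus.twoHalf_eq_comp, Function.comp_apply, Function.comp_apply]
    exact Torus.comp_planarProj_add_single (fun y => Torus.planarEmbed (g y, h y)) s x
  have hfs : Torus.IsSmooth (Torus.twoHalf g h) := hgs.twoHalf hhs
  have hfd : Torus.IsDivFree (Torus.twoHalf g h) := Torus.IsDivFree.twoHalf hgd h
  have hfz : Torus.HasZeroMean (Torus.twoHalf g h) :=
    Torus.hasZeroMean_twoHalf hgs.continuous.integrable_unitAddTorus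
      hhs.continuous.integrable_unitAddTorus hgz hhz
  obtain ⟨g', h', v₀, v, θ₀, θ, hgs', hgd', hgz', hhs', hhz', hfeq, -, hvLH, hθ₀, hθw, hEv, hEθ, hsplit⟩ :=
    ReductionOffZero.stub_reductionOffZero (Torus.twoHalf g h) hfinv hfs hfd hfz ν u₀ u hν hLH huinv hE
  obtain rfl : g = g' := Literature.Analysis.FluidPDE.Torus.twoHalf_left_injective hfeq
  obtain rfl : h = h' := Literature.Analysis.FluidPDE.Torus.twoHalf_right_injective hfeq
  have hplanar : Tendsto (fun j => meanDissipation (ν j) (v j)) atTop (𝓝 0) :=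
    PlanarNoAnomaly.stub_planarNoAnomaly g hgs hgd hgz ν v₀ v hν hν0 hvLH hEv
  have hsub := hS6g ν v₀ v hν hν0 hvLH hEv
  have hscalar : Tendsto (fun j => longTimeAvgSup
      (fun t => ν j * (Torus.eScalarGradNormSq (θ j t)).toReal)) atTop (𝓝 0) :=
    scalarNoAnomaly_of_subLogStrain_family g h hgs hgd hgz hhs hhz ν v₀ v θ₀ θ hν hν0 hvLH hEv hsub hθ₀
      hθw hEθ
  have hsum : Tendsto (fun j => meanDissipation (ν j) (v j) +
      longTimeAvgSup (fun t => ν j * (Torus.eScalarGradNormSq (θ j t)).toReal)) atTop (𝓝 0) := by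
    simpa using hplanar.add hscalar
  exact squeeze_zero (fun j => meanDissipation_nonneg (hν j).le (u j)) hsplit hsum


/-- **Registered tools stub `stub_perForceCertificate`** (conjunction of the two theorems of this
file, registered on stmt-AnomalousDissipation-0211 with `ledger workitem stub-add`): the per-family
engine and the per-force certificate. [folklore] -/
theorem stub_perForceCertificate :
    (∀ (g : UnitAddTorus (Fin 2) → EuclideanSpace ℝ (Fin 2)) (h : UnitAddTorus (Fin 2) → ℝ), Torus.IsSmooth g → Torus.IsDivFree g → Torus.HasZeroMean g → Torus.IsSmooth h → Torus.HasZeroMean h → ∀ (ν : ℕ → ℝ) (v₀ : ℕ → UnitAddTorus (Fin 2) → EuclideanSpace ℝ (Fin 2)) (v : ℕ → ℝ → UnitAddTorus (Fin 2) → EuclideanSpace ℝ (Fin 2)) (θ₀ : ℕ → UnitAddTorus (Fin 2) → ℝ) (θ : ℕ → ℝ → UnitAddTorus (Fin 2) → ℝ), (∀ j, 0 < ν j) → Tendsto ν atTop (𝓝 0) → (∀ j, Torus.IsGlobalLerayHopf (ν j) (fun _ => g) (v₀ j) (v j)) → (∃ E : ℝ, ∀ j, meanEnergy (v j) ≤ E)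 → Tendsto (fun j => longTimeAvgSup (fun t => Real.sqrt (Torus.eGradNormSq (v j t)).toReal) / Real.log (ν j)⁻¹) atTop (𝓝 0) → (∀ j, MemLp (θ₀ j) 2 volume) → (∀ j, Torus.IsWeakScalarTransportForced (ν j) (v j) (fun _ => h) (θ₀ j) (θ j)) → (∃ E : ℝ, ∀ j, longTimeAvgSup (fun t => Torus.scalarL2Sq (θ j t)) ≤ E) → Tendsto (fun j => longTimeAvgSup (fun t => ν j * (Torus.eScalarGradNormSq (θ j t)).toReal)) atTop (𝓝 0)) ∧ (∀ (g : UnitAddTorus (Fin 2) → EuclideanSpace ℝ (Fin 2)), Torus.IsSmooth g → Torus.IsDivFree g → Torus.HasZeroMean g → (∀ (ν : ℕ → ℝ) (v₀ : ℕ → UnitAddTorus (Fin 2) → EuclideanSpace ℝ (Fin 2)) (v : ℕ → ℝ → UnitAddTorus (Fin 2) → EuclideanSpace ℝ (Fin 2)), (∀ j, 0 < ν j) → Tendsto ν atTop (𝓝 0) → (∀ j, Torus.IsGlobalLerayHopf (ν j) (fun _ => g) (v₀ j) (v j)) → (∃ E : ℝ, ∀ j, meanEnergy (v j) ≤ E)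 → Tendsto (fun j => longTimeAvgSup (fun t => Real.sqrt (Torus.eGradNormSq (v j t)).toReal) / Real.log (ν j)⁻¹) atTop (𝓝 0)) → ∀ (h : UnitAddTorus (Fin 2) → ℝ), Torus.IsSmooth h → Torus.HasZeroMean h → ∀ (ν : ℕ → ℝ) (u₀ : ℕ → UnitAddTorus (Fin 3) → EuclideanSpace ℝ (Fin 3)) (u : ℕ → ℝ → UnitAddTorus (Fin 3) → EuclideanSpace ℝ (Fin 3)), (∀ j, 0 < ν j) → Tendsto ν atTop (𝓝 0) → (∀ j, Torus.IsGlobalLerayHopf (ν j) (fun _ => Torus.twoHalf g h) (u₀ j) (u j)) → (∀ j (t : ℝ) (s : UnitAddCircle) (x : UnitAddTorus (Fin 3)), u j t (x + Pi.single (2 : Fin 3) s) = u j t x) → (∃ E : ℝ, ∀ j, meanEnergy (u j) ≤ E) → Tendsto (fun j => meanDissipation (ν j) (u j)) atTop (𝓝 0)) :=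
  ⟨scalarNoAnomaly_of_subLogStrain_family, twohalfdNeg_twoHalf_of_subLogStrainFor⟩

end Summit.AnomalousDissipation.AnomalousDissipation.Theorems.TwohalfdNeg.PerForce
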